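import Literature.NumberTheory.Transcendental.DiazMainProofs
import Literature.NumberTheory.Transcendental.ExpSmallTrdegProofsI
import HarnessLib

/-!
# Diaz's `d × ℓ` grid, clause `t ≥ [dℓ/(ℓ+d)]` (`Diaz1989_grid`): the range `[dℓ/(ℓ+d)] ≤ 2`,
# proved, and what is left

Topic `Literature/NumberTheory/Transcendental`. Proof companion of `DiazGrid.lean` for the named
fact `Literature.NumberTheory.Transcendental.Diaz1989_grid` (Yu. V. Nesterenko, P. Philippon
(eds.), LNM 1752, Ch. 14 (M. Waldschmidt), Theorem 2.7, first conclusion with the Remark, quoted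
there as "the main result of G. Diaz in [Dia2]" = Diaz 1989, Théorème 2): for `ℚ`-linearly
independent `x₁, …, x_d` and `y₁, …, y_ℓ` satisfying the Technical Hypothesis (T.H.), `dℓ > ℓ + d`,
and any subfield `K ⊆ ℂ` containing the `dℓ` numbers `e^{xᵢyⱼ}`,
`t = trdeg_ℚ K ≥ [dℓ/(ℓ+d)]`.

A sibling file is needed because `DiazGrid.lean` sits below `DiazMain.lean` and
`DiazMainProofs.lean` in the import order.

Everything here is PROVED; no definition and no named fact is introduced.

* `DiazGrid.one_le_natDiv`, `DiazGrid.natDiv_le_two_iff`, `DiazGrid.natDiv_lt_three_of_min_le` —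
  arithmetic of the printed bound: under the standing hypothesis `dℓ > ℓ + d` one has
  `[dℓ/(ℓ+d)] ≥ 1`; `[dℓ/(ℓ+d)] ≤ 2` exactly in the range `dℓ < 3(ℓ+d)`, which contains every
  pair with `min(d, ℓ) ≤ 3` (and also `(4, 4), …, (4, 11)`, `(5, 5), (5, 6), (5, 7)`, and their
  transposes).
* `Diaz1989_grid.trdeg_adjoin_le` — any `K ∋ e^{xᵢyⱼ}` contains `ℚ(e^{xᵢyⱼ})`, so it suffices
  to bound the transcendence degree of the generated field (monotonicity of `trdeg`).
* `Diaz1989_grid.one_le_trdeg` — **`t ≥ 1` whenever `dℓ > ℓ + d`**, for `ℚ`-linearly independent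
  `x`, `y` and ANY `K ∋ e^{xᵢyⱼ}`, with no Technical Hypothesis: the six exponentials theorem on a
  `d × ℓ` grid (`one_le_trdeg_expGrid`, `DiazMainProofs.lean`, from the tree's PROVED
  `six_exponentials_holds`).
* `Diaz1989_grid.two_le_trdeg` — **`t ≥ 2` whenever `dℓ ≥ 2(ℓ + d)`**, again with no (T.H.): this
  is LNM 1752, Ch. 13, Theorem 3.1 (i) (= Ch. 14, Theorem 2.9, clause `t`; Gel'fond's method),
  which the tree PROVES (`Laurent2001_thm_3_1_i_holds`, `ExpSmallTrdegProofsI.lean`), transported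
  from `ℚ(e^{xᵢyⱼ})` to `K`.
* `Diaz1989_grid_midRange` — hence **the conclusion of `Diaz1989_grid` HOLDS outright in the range
  `dℓ < 3(ℓ+d)`** (there `[dℓ/(ℓ+d)] ≤ 2`), for all `ℚ`-linearly independent families and without
  (T.H.) (through the tree's `Diaz1989_main_i_midRange_of_thm_3_1_i`, Laurent 1991, Remarque 3);
  `Diaz1989_grid_of_min_le_three` — in particular whenever `min(d, ℓ) ≤ 3`.
* `Diaz1989_grid_of_largeRange` — reduction of the fact: it suffices to prove it in the
  complementary range `3(ℓ+d) ≤ dℓ` (`[dℓ/(ℓ+d)] ≥ 3`, so `d, ℓ ≥ 4`), where large transcendence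
  degree is asserted and Diaz's method is needed.

What is NOT here: the discharge `Diaz1989_grid_holds`. In the range `3(ℓ+d) ≤ dℓ` the only
printed proof (Diaz 1989, §II: a Schneider-type auxiliary function with coefficients in
`ℤ[e^{xᵢyⱼ}]`, Philippon's zero estimate on `𝔾ₐ × 𝔾ₘⁿ`, Philippon's criterion for algebraic
independence) is carried out in the tree CONDITIONALLY on the criterion: with Philippon's zero
estimate proved (`Philippon1986_GaGm_P1n_holds`, `Diaz1989_zeroLemma_holds`), the fact is
`Diaz1989_grid_of_mainCriterion : Philippon1986_mainCriterion → Diaz1989_grid`, equivalently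
`Diaz1989_grid_of_nesterenko` from the five named facts of LNM 1752 Ch. 3 §4 (Prop. 4.4, 4.7,
4.11, Cor. 4.12, Prop. 4.13; `DiazThm2Reductions.lean`), to which the tree reduces the criterion.
The discharge is that theorem fed with the discharges of those facts, once they land.

## References

* Yu. V. Nesterenko, P. Philippon (eds.), *Introduction to Algebraic Independence Theory*,
  LNM 1752, Springer 2001: Ch. 13 (M. Laurent), Theorem 3.1 (i), PDF p. 233; Ch. 14
  (M. Waldschmidt), Theorem 2.7 and Remark (PDF p. 248), Theorem 2.9 (PDF p. 249).
  [NesterenkoPhilippon2001]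
* G. Diaz, *Grands degrés de transcendance pour des familles d'exponentielles*, J. Number Theory
  31 (1989), 1–23, Théorème 2 (p. 2) (as quoted in LNM 1752, Ch. 14, Theorem 2.7). [Diaz1989]
* M. Laurent, *Sur quelques résultats récents de transcendance*, Astérisque 198–200 (1991),
  209–230, §3.1, Théorème 3 i) and Remarque 3 (pp. 213–214). [Laurent1991]
* S. Lang, *Introduction to transcendental numbers*, Addison-Wesley 1966, Ch. II §1, Theorem 1
  (six exponentials). [Lang1966]
-/

noncomputable section

open IntermediateField Complex

namespace Literature.NumberTheory.Transcendental

/-! ### Arithmetic of the bound `[dℓ/(ℓ+d)]` -/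

/-- Under the standing hypothesis `ℓ + d < dℓ` of Theorem 2.7 the printed bound for `t` is at least
`1`: `[dℓ/(ℓ+d)] ≥ 1`. [folklore] -/
theorem DiazGrid.one_le_natDiv {d l : ℕ} (h : l + d < d * l) : 1 ≤ d * l / (l + d) := by
  have hpos : 0 < l + d := by
    have := (two_le_of_add_lt_mul h).2.1
    omega
  exact (Nat.one_le_div_iff hpos).mpr h.le

/-- For `ℓ + d > 0`: `[dℓ/(ℓ+d)] ≤ 2 ↔ dℓ < 3(ℓ+d)`. [folklore] -/
theorem DiazGrid.natDiv_le_two_iff {d l : ℕ} (hpos : 0 < l + d) :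
    d * l / (l + d) ≤ 2 ↔ d * l < 3 * (l + d) := by
  rw [← Nat.lt_succ_iff, Nat.div_lt_iff_lt_mul hpos]

/-- Conversely, in the range `3(ℓ+d) ≤ dℓ` the printed bound is at least `3`, and `d, ℓ ≥ 4`.
[folklore] -/
theorem DiazGrid.three_le_natDiv {d l : ℕ} (h : 3 * (l + d) ≤ d * l) (hpos : 0 < l + d) :
    3 ≤ d * l / (l + d) ∧ 4 ≤ d ∧ 4 ≤ l := by
  refine ⟨(Nat.le_div_iff_mul_le hpos).mpr h, ?_, ?_⟩
  · by_contra hd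
    have hd' : d ≤ 3 := by omega
    have h1 : d * l ≤ 3 * l := Nat.mul_le_mul_right l hd'
    have hd0 : d = 0 := by omega
    subst hd0
    omega
  · by_contra hl
    have hl' : l ≤ 3 := by omega
    have h1 : d * l ≤ d * 3 := Nat.mul_le_mul_left d hl'
    have hl0 : l = 0 := by omega
    subst hl0
    omega

/-- Every pair `(d, ℓ)` with `ℓ + d < dℓ` and `min(d, ℓ) ≤ 3` lies in the range `dℓ < 3(ℓ+d)`
(`[dℓ/(ℓ+d)] ≤ 2`): `d = 2, 3` with any `ℓ`, `ℓ = 2, 3` with any `d`. [folklore] -/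
theorem DiazGrid.natDiv_lt_three_of_min_le {d l : ℕ} (h : l + d < d * l) (h3 : min d l ≤ 3) :
    d * l < 3 * (l + d) := by
  have hpos : 0 < l + d := by
    have := (two_le_of_add_lt_mul h).2.1
    omega
  by_contra hge
  have := DiazGrid.three_le_natDiv (Nat.le_of_not_lt hge) hpos
  rcases Nat.le_total d l with hdl | hdl
  · rw [Nat.min_eq_left hdl] at h3
    omega
  · rw [Nat.min_eq_right hdl] at h3
    omega

/-! ### From the generated field `ℚ(e^{xᵢyⱼ})` to any `K ∋ e^{xᵢyⱼ}` -/

/-- Any subfield `K ⊆ ℂ` containing the `e^{xᵢyⱼ}` contains `ℚ(e^{xᵢyⱼ})`, so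
`trdeg_ℚ ℚ(e^{xᵢyⱼ}) ≤ trdeg_ℚ K` (monotonicity of the transcendence degree,
`DiazMain.trdeg_mono`). This is why Theorem 2.7 may quantify over "a subfield `K` of `ℂ` which
contains the `dℓ` numbers `e^{xᵢyⱼ}`". [folklore] -/
theorem Diaz1989_grid.trdeg_adjoin_le {d l : ℕ} {x : Fin d → ℂ} {y : Fin l → ℂ}
    {K : IntermediateField ℚ ℂ} (hK : ∀ i j, cexp (x i * y j) ∈ K) :
    Algebra.trdeg ℚ ↥(adjoin ℚ (Set.range fun p : Fin d × Fin l => cexp (x p.1 * y p.2))) ≤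
      Algebra.trdeg ℚ ↥K :=
  DiazMain.trdeg_mono (adjoin_le_iff.mpr (by rintro _ ⟨p, rfl⟩; exact hK p.1 p.2))

/-! ### `t ≥ 1` and `t ≥ 2` without the Technical Hypothesis -/

/-- **`t ≥ 1` on the whole range of Theorem 2.7, with no Technical Hypothesis**: if `x₁, …, x_d`
and `y₁, …, y_ℓ` are each `ℚ`-linearly independent and `dℓ > ℓ + d` (i.e. `d ≥ 2, ℓ ≥ 3` or
`d ≥ 3, ℓ ≥ 2`), then every subfield `K ⊆ ℂ` containing the `e^{xᵢyⱼ}` has `trdeg_ℚ K ≥ 1` — one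
of the `e^{xᵢyⱼ}` is transcendental by the six exponentials theorem (`one_le_trdeg_expGrid`).
[cite: Lang1966, Ch. II §1 Thm. 1]
[cite: NesterenkoPhilippon2001, Ch. 14 Thm 2.7 (t), p. 248 (case [dℓ/(ℓ+d)] = 1)] -/
theorem Diaz1989_grid.one_le_trdeg {d l : ℕ} (x : Fin d → ℂ) (y : Fin l → ℂ)
    (hx : LinearIndependent ℚ x) (hy : LinearIndependent ℚ y) (h : l + d < d * l)
    (K : IntermediateField ℚ ℂ) (hK : ∀ i j, cexp (x i * y j) ∈ K) :
    (1 : Cardinal) ≤ Algebra.trdeg ℚ ↥K :=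
  (one_le_trdeg_expGrid x y hx hy (two_le_of_add_lt_mul h).1).trans
    (Diaz1989_grid.trdeg_adjoin_le hK)

/-- **`t ≥ 2` for `dℓ ≥ 2(ℓ + d)`, with no Technical Hypothesis**: if `x₁, …, x_d` and
`y₁, …, y_ℓ` are each `ℚ`-linearly independent and `dℓ ≥ 2d + 2ℓ`, then every subfield `K ⊆ ℂ`
containing the `e^{xᵢyⱼ}` has `trdeg_ℚ K ≥ 2`. This is LNM 1752, Ch. 13, Theorem 3.1 (i)
(`trdeg_ℚ ℚ(e^{xᵢyⱼ}) ≥ 2`; = Ch. 14, Theorem 2.9, clause `t`), PROVED in the tree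
(`Laurent2001_thm_3_1_i_holds`), transported to `K ⊇ ℚ(e^{xᵢyⱼ})`.
[cite: NesterenkoPhilippon2001, Ch. 13 Thm 3.1 (i), p. 233; Ch. 14 Thm 2.9, p. 249] -/
theorem Diaz1989_grid.two_le_trdeg {d l : ℕ} (x : Fin d → ℂ) (y : Fin l → ℂ)
    (hx : LinearIndependent ℚ x) (hy : LinearIndependent ℚ y) (h2 : 2 * (l + d) ≤ d * l)
    (hd : 1 ≤ d) (hl : 1 ≤ l)
    (K : IntermediateField ℚ ℂ) (hK : ∀ i j, cexp (x i * y j) ∈ K) :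
    (2 : Cardinal) ≤ Algebra.trdeg ℚ ↥K :=
  (Laurent2001_thm_3_1_i_holds d l x y hd hl hx hy (by omega)).trans
    (Diaz1989_grid.trdeg_adjoin_le hK)

/-! ### The conclusion of Theorem 2.7 (t) in the range `[dℓ/(ℓ+d)] ≤ 2`, unconditionally -/

/-- **`Diaz1989_grid` in the range `dℓ < 3(ℓ+d)`, PROVED, for all `ℚ`-linearly independent
families and with no Technical Hypothesis.** There `[dℓ/(ℓ+d)] ≤ 2`: the value `1`
(`dℓ < 2(ℓ+d)`) is the six exponentials theorem and the value `2` (`2(ℓ+d) ≤ dℓ < 3(ℓ+d)`) is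
LNM 1752 Ch. 13 Thm 3.1 (i) — both proved in the tree and combined in
`Diaz1989_main_i_midRange_of_thm_3_1_i` (Laurent 1991, Remarque 3: no measure of linear
independence is needed in transcendence degree `≤ 2`); the bound passes from `ℚ(e^{xᵢyⱼ})` to any
`K ∋ e^{xᵢyⱼ}` by `Diaz1989_grid.trdeg_adjoin_le`.
[cite: NesterenkoPhilippon2001, Ch. 14 Thm 2.7 (t) + Remark, p. 248 (range [dℓ/(ℓ+d)] ≤ 2)]
[cite: Laurent1991, §3.1 Remarque 3, p. 214] -/
theorem Diaz1989_grid_midRange (d l : ℕ) (x : Fin d → ℂ) (y : Fin l → ℂ)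
    (hx : LinearIndependent ℚ x) (hy : LinearIndependent ℚ y) (h : l + d < d * l)
    (hmid : d * l < 3 * (l + d)) (K : IntermediateField ℚ ℂ) (hK : ∀ i j, cexp (x i * y j) ∈ K) :
    ((d * l / (l + d) : ℕ) : Cardinal) ≤ Algebra.trdeg ℚ ↥K := by
  have hmain := Diaz1989_main_i_midRange_of_thm_3_1_i Laurent2001_thm_3_1_i_holds d l x y hx hy
    (two_le_of_add_lt_mul h).1 (by rwa [Nat.add_comm d l])
  rw [Nat.add_comm d l] at hmain
  exact hmain.trans (Diaz1989_grid.trdeg_adjoin_le hK)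

/-- **`Diaz1989_grid` whenever `min(d, ℓ) ≤ 3`, PROVED** (no Technical Hypothesis): `d ∈ {2, 3}`
with any `ℓ`, or `ℓ ∈ {2, 3}` with any `d`, lie in the range `dℓ < 3(ℓ+d)` of
`Diaz1989_grid_midRange`.
[cite: NesterenkoPhilippon2001, Ch. 14 Thm 2.7 (t) + Remark, p. 248 (case min(d, ℓ) ≤ 3)] -/
theorem Diaz1989_grid_of_min_le_three (d l : ℕ) (x : Fin d → ℂ) (y : Fin l → ℂ)
    (hx : LinearIndependent ℚ x) (hy : LinearIndependent ℚ y) (h : l + d < d * l)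
    (h3 : min d l ≤ 3) (K : IntermediateField ℚ ℂ) (hK : ∀ i j, cexp (x i * y j) ∈ K) :
    ((d * l / (l + d) : ℕ) : Cardinal) ≤ Algebra.trdeg ℚ ↥K :=
  Diaz1989_grid_midRange d l x y hx hy h (DiazGrid.natDiv_lt_three_of_min_le h h3) K hK

/-! ### What is left: the range `3(ℓ+d) ≤ dℓ` -/

/-- **Reduction of `Diaz1989_grid` to its large range.** Since the range `dℓ < 3(ℓ+d)` is settled
unconditionally (`Diaz1989_grid_midRange`), the named fact follows from its restriction to
`3(ℓ+d) ≤ dℓ` — where `[dℓ/(ℓ+d)] ≥ 3`, `d, ℓ ≥ 4` (`DiazGrid.three_le_natDiv`), and Diaz's method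
(Philippon's criterion for algebraic independence with his zero estimate) is needed; cf.
`Diaz1989_grid_of_mainCriterion` / `Diaz1989_grid_of_nesterenko` (`DiazThm2Reductions.lean`) for
the whole fact conditionally on the criterion.
[cite: NesterenkoPhilippon2001, Ch. 14 Thm 2.7 (t) + Remark, p. 248]
[cite: Diaz1989, Théorème 2, p. 2] -/
theorem Diaz1989_grid_of_largeRange
    (H : ∀ (d l : ℕ) (x : Fin d → ℂ) (y : Fin l → ℂ),
      LinearIndependent ℚ x → TechnicalHypothesis x →
      LinearIndependent ℚ y → TechnicalHypothesis y → 3 * (l + d) ≤ d * l →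
      ∀ K : IntermediateField ℚ ℂ, (∀ i j, cexp (x i * y j) ∈ K) →
        ((d * l / (l + d) : ℕ) : Cardinal) ≤ Algebra.trdeg ℚ ↥K) :
    Diaz1989_grid := by
  intro d l x y hx hxT hy hyT h K hK
  rcases Nat.lt_or_ge (d * l) (3 * (l + d)) with hmid | hlarge
  · exact Diaz1989_grid_midRange d l x y hx hy h hmid K hK
  · exact H d l x y hx hxT hy hyT hlarge K hK

end Literature.NumberTheory.Transcendental

end
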